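/-
Copyright (c) 2026 the pub-hodgecm-mathlib formalisation cell (harness21).  Prover seat hodgecm-mathlib-LH4-p04 (g5), Track A «(D-RAM) FOUR-FRAME», unit U2H, the census leaf
(ρ2b′-X) `stub_U2H_fixedPointCensus_typeTwo_unit0` — socket (C) (type RamM bottom, dealer WORD #30: lead LH4-p04 + LH4-p06), organ (C-5c) S6b-RM «REALISABILITY OF THE TOKENS»:
the parity ∕ position law of the plane token `m` against the conductor level `jl` in the RAMIFIED frame.  2026-09-04.
-/
import Literature.NumberTheory.Automorphic.UnitaryThreeFourFrameDefs   -- D `IsRamifiedQuadraticDatum` (only for the docstring's vocabulary; the theorems are datum-free)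
import HarnessLib

/-!
# F0 · P3c · line LH4 «(D-RAM) FOUR-FRAME» — leaf (ρ2b′-X), socket (C) type RamM, organ (C-5c) S6b-RM: REALISABILITY OF THE T5s-RamM TOKENS
# `m ≡ d (2) ⇒ m + s0 ≤ jl`, `m ≢ d (2) ⇒ jl = m + s0 − 1` (Serre 1979 Ch. IV §1, Ch. V §3; Rogawski 1990 §4.9)

Cell `pub/hodgecm-mathlib` (D-0151), crux H413 = `stmt-HodgeConjecture-24833` (helper lane `--supports stmt-HodgeConjecture-24833 --as helper`, count-neutral); THEOREMS ONLY (no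
definition, no instance, no notation, no named fact, no `sorry`, default heartbeats).  Socket served: the typed order-count socket (C) `SOCKET-hOCC.v1` 869d0c15 (payer LH4-p14, MAP v3):
the RamM bottom `orderCountCensusC` quotes T5s EDITION 2 `toricCensusSum_ramM_v2` (LH4-p04 (g5)), whose token binder `hparW : m % 2 = (g + s0) % 2 ∨ jl + 2 ≤ m + 2g + s0` THIS FILE
discharges from the frame.

THE LAW (one valued field `K` = the completed line `M`; commuting isometric involutions `ρ` (`= Gal(M∕L_w)`), `Θ` (extending `σ_w`); E-letter `ω` = `ι(ϖ − σ_wϖ)` (`ρω = ω`,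
`Θω = −ω`, `|ω| = exp(−2d)`, `d` = the E-datum exponent); K♮-letter `P = ϖM·ΘϖM` (`ΘP = P`, `|P| = exp(−2)`, `|P − ρP| = exp(−2d′)`); `|2| = exp(−2tE)`; F-elements (fixed by `ρ`
AND `Θ`) have order in `4ℤ` (`hF4`); the dictionary `2d′ = dρ + 2s0` (★ `KleinDifferentLetters.add_eq_two_mul` at the pair `(Θ, ρ)`)).  For a `Θ`-unitary `λ` (`Θλ·λ = 1`) and a
`ρ`-fixed `Θ`-unitary `u` with tokens `|λ − u| = exp(−2m)`, `|(λ − u) − ρ(λ − u)| = exp(−(2jl + dρ))` and depth `d′ + tE ≤ m`: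
**`m ≡ d (mod 2) ⇒ m + s0 ≤ jl`** and **`m ≢ d (mod 2) ⇒ jl + 1 = m + s0`** (`realizable_of_frame_ramM`).  Evidence before the proof: F0P3a-p01 (g32)'s E1 RamM rows (206, all
obey it: off-parity rows are exactly `jl = m + s0 − 1`) and a ℚ₂(ζ₈) lab over all four (ρ, Θ) cells (LH4-p04 (g5) `work/s6b/lab.py`: 0 exceptions for `m ≥ 3`).
PROOF.  `ξ := λΘu − 1 = (λ − u)·Θu` has `|ξ| = exp(−2m)`, `|ξ − ρξ| = exp(−(2jl + dρ))` and, by unitarity, `ξ + Θξ = −ξ·Θξ` (order `4m`).  Split `2ξ = (ξ + Θξ) + (ξ − Θξ)`: the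
`Θ`-ANTI part `ξ⁻ := ξ − Θξ` has `|ξ⁻| = |2ξ| = exp(−2tE − 2m)` (`m > tE`) and `ξ⁻ = ω·k` with `k` `Θ`-FIXED of order `2tE + 2m − 2d ≡ 2(m − d) (mod 4)` (`tE` is even by `hF4`).
§1 THE K♮-LAW (`v_sub_map_eq_of_thetaFixed_odd` ∕ `v_sub_map_le_of_thetaFixed_even`): for `Θ`-fixed `k` with coordinates `k = a + bP` (`a, b` fixed by both involutions, orders in
`4ℤ`): order `≡ 2 (4)` ⇒ `|k − ρk| = |k|·exp(2 − 2d′)` EXACTLY; order `≡ 0 (4)` ⇒ `|k − ρk| ≤ |k|·exp(−2d′)`.  §2: `2(ξ − ρξ) = (ξ⁺ − ρξ⁺) + ω(k − ρk)` with `|ξ⁺| = exp(−4m)`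
negligible under `d′ + tE ≤ m`; reading off `2jl + dρ` gives the two branches.
HONEST LABEL: HC_CM is proved only modulo the 7 printed citations (2 remaining named inputs: hLiu418 = stmt-HodgeConjecture-24832, h413 = stmt-HodgeConjecture-24833) until rung 0
closes; (ρ2b′-X) :418 is an OPEN prover target — this file is a helper (`--supports`), proofs only; nothing printed is asserted.

## References
* [Serre1979] J.-P. Serre, *Local Fields*, GTM 67 (1979): Ch. I §6 Prop. 18 (Eisenstein coordinates), Ch. IV §1 Prop. 3–4, Ch. V §3 Cor. 3 (depths of `x∕σx` on the unit filtration).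
* [Rogawski1990] J. D. Rogawski, *Automorphic Representations of Unitary Groups in Three Variables*, Ann. of Math. Stud. 123 (1990), §4.9 p. 55, Lemma 4.9.3 p. 56 (the tokens of a type-(2) element).
-/

set_option autoImplicit false

noncomputable section

namespace Summit.HodgeConjecture.HodgeConjecture.Cruxes.H413.F0P3cDyRamTokenRealizabilityRamM

open WithZero
open scoped Valued

variable {K : Type} [Field K] [Valued K ℤᵐ⁰] {ρ Θ : K →+* K}

/-! ## §0 Small valuation facts -/

/-- `|x| = exp e` form of a nonzero element's order. [cite: Serre1979, Ch. IV §1 Prop. 3–4] -/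
theorem exists_v_eq_exp {x : K} (hx : x ≠ 0) : ∃ e : ℤ, Valued.v x = exp e :=
  ⟨_, (exp_log ((Valuation.ne_zero_iff _).2 hx)).symm⟩

/-- An F-element (fixed by `ρ` and `Θ`) that happens to be `2`: `|2| = exp(−2tE)` and `hF4` force `tE` even. [cite: Serre1979, Ch. IV §1 Prop. 3–4] -/
theorem even_tE (hF4 : ∀ z : K, ρ z = z → Θ z = z → z ≠ 0 → ∃ n : ℤ, Valued.v z = exp (4 * n))
    {tE : ℕ} (h2 : Valued.v (2 : K) = exp (-(2 * (tE : ℤ)))) : (tE : ℤ) % 2 = 0 := by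
  have h20 : (2 : K) ≠ 0 := fun h0 => by rw [h0, map_zero] at h2; exact (exp_ne_zero h2.symm).elim
  obtain ⟨n, hn⟩ := hF4 2 (map_ofNat ρ 2) (map_ofNat Θ 2) h20
  rw [h2, exp_inj] at hn
  omega

/-! ## §1 The K♮-law: `ρ`-depth of a `Θ`-fixed element from the parity of its order -/

omit [Valued K ℤᵐ⁰] in
/-- **COORDINATES OF A `Θ`-FIXED ELEMENT**: with `P` `Θ`-fixed and `ρP ≠ P`, every `Θ`-fixed `k` is `a + b·P` with `a, b` fixed by BOTH `ρ` and `Θ` (`b = (k − ρk)∕(P − ρP)`,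
`a = k − bP`; `Θρ = ρΘ`). [cite: Serre1979, Ch. I §6 Prop. 18] -/
theorem exists_fixed_fixed_coords (hρρ : ∀ x, ρ (ρ x) = x) (hΘρ : ∀ x, Θ (ρ x) = ρ (Θ x)) {P : K} (hΘP : Θ P = P) (hρP : ρ P ≠ P)
    {k : K} (hΘk : Θ k = k) :
    ∃ a b : K, ρ a = a ∧ Θ a = a ∧ ρ b = b ∧ Θ b = b ∧ k = a + b * P ∧ k - ρ k = b * (P - ρ P) := by
  have hd : P - ρ P ≠ 0 := sub_ne_zero.2 (Ne.symm hρP)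
  set b : K := (k - ρ k) / (P - ρ P) with hb
  have hρb : ρ b = b := by
    rw [hb, map_div₀, map_sub, map_sub, hρρ, hρρ, ← neg_sub k, ← neg_sub P, neg_div_neg_eq]
  have hΘb : Θ b = b := by
    rw [hb, map_div₀, map_sub, map_sub, hΘρ, hΘρ, hΘk, hΘP]
  have key : k - ρ k = b * (P - ρ P) := by rw [hb, div_mul_cancel₀ _ hd]
  clear_value b
  refine ⟨k - b * P, b, ?_, ?_, hρb, hΘb, by ring, key⟩
  · rw [map_sub, map_mul, hρb]; linear_combination -key
  · rw [map_sub, map_mul, hΘb, hΘP, hΘk]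

/-- **THE K♮-LAW, ODD CASE**: a `Θ`-fixed `k` of order `≡ 2 (mod 4)` (odd K♮-order) is moved by `ρ` EXACTLY by `exp(2 − 2d′)`: `|k − ρk| = |k|·exp(2 − 2d′)` — in coordinates
`k = a + bP` the odd order is carried by `bP`. [cite: Serre1979, Ch. IV §1 Prop. 3–4] [cite: Serre1979, Ch. V §3 Cor. 3] -/
theorem v_sub_map_eq_of_thetaFixed_odd (hρρ : ∀ x, ρ (ρ x) = x) (hΘρ : ∀ x, Θ (ρ x) = ρ (Θ x))
    (hF4 : ∀ z : K, ρ z = z → Θ z = z → z ≠ 0 → ∃ n : ℤ, Valued.v z = exp (4 * n))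
    {P : K} (hΘP : Θ P = P) (hP : Valued.v P = exp (-2 : ℤ)) {d' : ℕ} (hdP : Valued.v (P - ρ P) = exp (-(2 * (d' : ℤ))))
    {k : K} (hΘk : Θ k = k) {n : ℤ} (hk : Valued.v k = exp (4 * n + 2)) :
    Valued.v (k - ρ k) = Valued.v k * exp (2 - 2 * (d' : ℤ)) := by
  have hρP : ρ P ≠ P := fun h => by rw [h, sub_self, map_zero] at hdP; exact exp_ne_zero hdP.symm
  obtain ⟨a, b, hρa, hΘa, hρb, hΘb, hkab, hkey⟩ := exists_fixed_fixed_coords hρρ hΘρ hΘP hρP hΘk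
  -- `|bP| ∈ exp(4ℤ + 2)` hits `|k|`, `|a| ∈ exp(4ℤ)` cannot
  have hb0 : b ≠ 0 := by
    rintro rfl
    rw [zero_mul, add_zero] at hkab
    subst hkab
    by_cases ha0 : k = 0
    · rw [ha0, map_zero] at hk; exact (exp_ne_zero hk.symm).elim
    obtain ⟨n', hn'⟩ := hF4 k hρa hΘa ha0
    rw [hk, exp_inj] at hn'; omega
  obtain ⟨nb, hnb⟩ := hF4 b hρb hΘb hb0
  have hbP : Valued.v (b * P) = exp (4 * nb - 2) := by rw [map_mul, hnb, hP, ← exp_add]; rfl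
  have hva : Valued.v a ≠ Valued.v (b * P) := by
    intro h
    by_cases ha0 : a = 0
    · rw [ha0, map_zero, hbP] at h; exact (exp_ne_zero h.symm).elim
    obtain ⟨na, hna⟩ := hF4 a hρa hΘa ha0
    rw [hna, hbP, exp_inj] at h; omega
  have hkv : Valued.v k = Valued.v (b * P) := by
    rw [hkab]
    rcases lt_or_gt_of_ne hva with hlt | hgt
    · -- `|a| < |bP|`: then `|k| = |bP|`
      exact Valuation.map_add_eq_of_lt_right _ hlt
    · -- `|bP| < |a|`: then `|k| = |a| ∈ exp(4ℤ)`, contradicting the order `4n + 2`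
      exfalso
      have hka : Valued.v (a + b * P) = Valued.v a := Valuation.map_add_eq_of_lt_left _ hgt
      have ha0 : a ≠ 0 := fun h0 => by rw [h0, map_zero] at hgt; exact not_lt_zero hgt
      obtain ⟨na, hna⟩ := hF4 a hρa hΘa ha0
      rw [← hkab] at hka
      rw [hka, hna, exp_inj] at hk; omega
  rw [hkey, map_mul, hdP, hkv, hbP, hnb, ← exp_add, ← exp_add]
  congr 1; ring

/-- **THE K♮-LAW, EVEN CASE**: a `Θ`-fixed `k` of order `≡ 0 (mod 4)` is moved by `ρ` AT LEAST by `exp(−2d′)`: `|k − ρk| ≤ |k|·exp(−2d′)` — now `|k| = |a|` and `|b| ≤ |k|`.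
[cite: Serre1979, Ch. IV §1 Prop. 3–4] [cite: Serre1979, Ch. V §3 Cor. 3] -/
theorem v_sub_map_le_of_thetaFixed_even (hρρ : ∀ x, ρ (ρ x) = x) (hΘρ : ∀ x, Θ (ρ x) = ρ (Θ x))
    (hF4 : ∀ z : K, ρ z = z → Θ z = z → z ≠ 0 → ∃ n : ℤ, Valued.v z = exp (4 * n))
    {P : K} (hΘP : Θ P = P) (hP : Valued.v P = exp (-2 : ℤ)) {d' : ℕ} (hdP : Valued.v (P - ρ P) = exp (-(2 * (d' : ℤ))))
    {k : K} (hΘk : Θ k = k) {n : ℤ} (hk : Valued.v k = exp (4 * n)) :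
    Valued.v (k - ρ k) ≤ Valued.v k * exp (-(2 * (d' : ℤ))) := by
  have hρP : ρ P ≠ P := fun h => by rw [h, sub_self, map_zero] at hdP; exact exp_ne_zero hdP.symm
  obtain ⟨a, b, hρa, hΘa, hρb, hΘb, hkab, hkey⟩ := exists_fixed_fixed_coords hρρ hΘρ hΘP hρP hΘk
  rw [hkey, map_mul, hdP, hk]
  by_cases hb0 : b = 0
  · rw [hb0, map_zero, zero_mul]; exact zero_le
  obtain ⟨nb, hnb⟩ := hF4 b hρb hΘb hb0
  have hbP : Valued.v (b * P) = exp (4 * nb - 2) := by rw [map_mul, hnb, hP, ← exp_add]; rfl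
  -- `|bP| ≠ |k|` (residues mod 4), and `|bP| > |k|` would force `|a| = |bP|`, impossible; so `|bP| < |k|`, i.e. `4nb − 2 < 4n`, `nb ≤ n`
  have hle : nb ≤ n := by
    by_contra hlt
    have hgt : Valued.v k < Valued.v (b * P) := by rw [hk, hbP, exp_lt_exp]; omega
    -- then `|a| = |bP|`: from `a = k − bP`
    have ha : a = (a + b * P) - b * P := by ring
    have hva : Valued.v a = Valued.v (b * P) := by
      rw [ha, ← hkab, Valuation.map_sub_swap, Valuation.map_sub_eq_of_lt_left _ hgt]
    have ha0 : a ≠ 0 := fun h0 => by rw [h0, map_zero, hbP] at hva; exact exp_ne_zero hva.symm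
    obtain ⟨na, hna⟩ := hF4 a hρa hΘa ha0
    rw [hna, hbP, exp_inj] at hva; omega
  rw [hnb, ← exp_add, ← exp_add, exp_le_exp]; omega

/-! ## §2 The realisability law -/

/-- **S6b-RM: REALISABILITY OF THE T5s-RamM TOKENS.**  In the RAMIFIED frame (letters of the module docstring: `ρ, Θ` commuting isometric involutions; `hF4`; the E-letter `ω` with
`ρω = ω`, `Θω = −ω`, `|ω| = exp(−2d)`; the K♮-letter `P` with `ΘP = P`, `|P| = exp(−2)`, `|P − ρP| = exp(−2d′)`; `|2| = exp(−2tE)`; the dictionary `2d′ = dρ + 2s0`), a `Θ`-unitary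
`λ` and a `ρ`-fixed `Θ`-unitary `u` with tokens `|λ − u| = exp(−2m)`, `|(λ − u) − ρ(λ − u)| = exp(−(2jl + dρ))` at depth `d′ + tE ≤ m` satisfy
**`m ≡ d (2) → m + s0 ≤ jl`** and **`m ≢ d (2) → jl + 1 = m + s0`** — so T5s EDITION 2's `hparW` (and `hm : m ≤ jl`) hold. [cite: Serre1979, Ch. IV §1 Prop. 3–4]
[cite: Serre1979, Ch. V §3 Cor. 3] [cite: Rogawski1990, §4.9 p. 55, Lemma 4.9.3 p. 56] -/
theorem realizable_of_frame_ramM (hρρ : ∀ x, ρ (ρ x) = x) (hvρ : ∀ x, Valued.v (ρ x) = Valued.v x)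
    (hΘΘ : ∀ x, Θ (Θ x) = x) (hΘρ : ∀ x, Θ (ρ x) = ρ (Θ x)) (hvΘ : ∀ x, Valued.v (Θ x) = Valued.v x)
    (hF4 : ∀ z : K, ρ z = z → Θ z = z → z ≠ 0 → ∃ n : ℤ, Valued.v z = exp (4 * n))
    {P : K} (hΘP : Θ P = P) (hP : Valued.v P = exp (-2 : ℤ)) {d' : ℕ} (hdP : Valued.v (P - ρ P) = exp (-(2 * (d' : ℤ))))
    {ω : K} (hρω : ρ ω = ω) (hΘω : Θ ω = -ω) {d : ℕ} (hω : Valued.v ω = exp (-(2 * (d : ℤ))))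
    {tE : ℕ} (h2 : Valued.v (2 : K) = exp (-(2 * (tE : ℤ)))) {dρ s0 : ℕ} (hd' : 2 * d' = dρ + 2 * s0)
    {lam u : K} (hlam : Θ lam * lam = 1) (hu : ρ u = u) (hu1 : u * Θ u = 1)
    {m jl : ℕ} (hm : Valued.v (lam - u) = exp (-(2 * (m : ℤ)))) (hjl : Valued.v ((lam - u) - ρ (lam - u)) = exp (-(2 * (jl : ℤ) + dρ)))
    (hd1 : 1 ≤ d') (hdepth : d' + tE ≤ m) :
    (m % 2 = d % 2 → m + s0 ≤ jl) ∧ (m % 2 ≠ d % 2 → jl + 1 = m + s0) := by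
  have h20 : (2 : K) ≠ 0 := fun h0 => by rw [h0, map_zero] at h2; exact (exp_ne_zero h2.symm).elim
  have htE := even_tE (ρ := ρ) (Θ := Θ) hF4 h2
  have hω0 : ω ≠ 0 := fun h0 => by rw [h0, map_zero] at hω; exact (exp_ne_zero hω.symm).elim
  have hvΘu : Valued.v (Θ u) = 1 := by
    have h := congrArg Valued.v hu1
    rw [map_mul, map_one, hvΘ] at h
    have hvu : Valued.v u = 1 := by
      by_contra hne
      rcases lt_or_gt_of_ne hne with hlt | hgt
      · exact absurd h (ne_of_lt (by simpa using mul_lt_one' hlt hlt))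
      · exact absurd h (ne_of_gt (by simpa using one_lt_mul'' hgt hgt))
    rw [hvΘ, hvu]
  -- `ξ := λΘu − 1 = (λ − u)Θu`
  obtain ⟨ξ, hξ⟩ : ∃ x : K, x = (lam - u) * Θ u := ⟨_, rfl⟩
  have hvξ : Valued.v ξ = exp (-(2 * (m : ℤ))) := by rw [hξ, map_mul, hm, hvΘu, mul_one]
  have hξρ : ξ - ρ ξ = ((lam - u) - ρ (lam - u)) * Θ u := by
    rw [hξ, map_mul, ← hΘρ, hu]; ring
  have hvξρ : Valued.v (ξ - ρ ξ) = exp (-(2 * (jl : ℤ) + dρ)) := by rw [hξρ, map_mul, hjl, hvΘu, mul_one]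
  -- unitarity: `ξ + Θξ = −ξ·Θξ`
  have hunit : ξ + Θ ξ = -(ξ * Θ ξ) := by
    have h1 : ξ = lam * Θ u - 1 := by rw [hξ]; linear_combination -(hu1)
    have h2' : Θ ξ = Θ lam * u - 1 := by rw [h1, map_sub, map_mul, hΘΘ, map_one]
    rw [h2', h1]
    -- `(λΘu − 1) + (Θλ·u − 1) + (λΘu − 1)(Θλ·u − 1) = (Θλ·λ)(uΘu) − 1 = 0`
    linear_combination (u * Θ u) * hlam + hu1
  -- the split `2ξ = ξ⁺ + ξ⁻`
  obtain ⟨ξp, hξp⟩ : ∃ x : K, x = ξ + Θ ξ := ⟨_, rfl⟩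
  obtain ⟨ξm, hξm⟩ : ∃ x : K, x = ξ - Θ ξ := ⟨_, rfl⟩
  have hsplit : 2 * ξ = ξp + ξm := by rw [hξp, hξm]; ring
  have hvξp : Valued.v ξp = exp (-(4 * (m : ℤ))) := by
    rw [hξp, hunit, Valuation.map_neg, map_mul, hvΘ, hvξ, ← exp_add]; congr 1; ring
  have hΘξm : Θ ξm = -ξm := by rw [hξm, map_sub, hΘΘ]; ring
  have hv2ξ : Valued.v (2 * ξ) = exp (-(2 * (tE : ℤ)) - 2 * m) := by rw [map_mul, h2, hvξ, ← exp_add]; rfl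
  have hvξm : Valued.v ξm = exp (-(2 * (tE : ℤ)) - 2 * m) := by
    have hlt : Valued.v ξp < Valued.v (2 * ξ) := by rw [hvξp, hv2ξ, exp_lt_exp]; omega
    have : ξm = 2 * ξ - ξp := by rw [hsplit]; ring
    rw [this]
    exact (Valuation.map_sub_eq_of_lt_left _ hlt).trans hv2ξ
  -- `k := ξ⁻ ∕ ω` is `Θ`-fixed of order `2tE + 2m − 2d`
  obtain ⟨k, hk⟩ : ∃ x : K, x = ξm / ω := ⟨_, rfl⟩
  have hΘk : Θ k = k := by rw [hk, map_div₀, hΘξm, hΘω, neg_div_neg_eq]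
  have hξmk : ξm = ω * k := by rw [hk, mul_div_cancel₀ _ hω0]
  have hvk : Valued.v k = exp (-(2 * (tE : ℤ)) - 2 * m + 2 * d) := by
    rw [hk, map_div₀, hvξm, hω, ← exp_sub]; congr 1; ring
  -- `2(ξ − ρξ) = (ξ⁺ − ρξ⁺) + ω(k − ρk)`
  have hdec : 2 * (ξ - ρ ξ) = (ξp - ρ ξp) + ω * (k - ρ k) := by
    have h2ρ : ρ (2 * ξ) = 2 * ρ ξ := by rw [map_mul, map_ofNat]
    have : 2 * (ξ - ρ ξ) = (2 * ξ) - ρ (2 * ξ) := by rw [h2ρ]; ring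
    rw [this, hsplit, map_add, hξmk, map_mul, hρω]; ring
  have hv2diff : Valued.v (2 * (ξ - ρ ξ)) = exp (-(2 * (tE : ℤ)) - (2 * jl + dρ)) := by
    rw [map_mul, h2, hvξρ, ← exp_add]; rfl
  have hvp : Valued.v (ξp - ρ ξp) ≤ exp (-(4 * (m : ℤ))) := by
    rw [← hvξp]
    exact (Valuation.map_sub _ _ _).trans (max_le le_rfl (by rw [hvρ]))
  -- the two branches by the parity of `m − d` (`tE` even): the order of `k` is `4n + 2` or `4n`
  constructor
  · intro hpar
    -- even K♮-order: `|ω(k − ρk)| ≤ exp(−2tE − 2m − 2d′)`, `|ξ⁺ − ρξ⁺| ≤ exp(−4m) ≤` the same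
    obtain ⟨n, hn⟩ : ∃ n : ℤ, -(2 * (tE : ℤ)) - 2 * m + 2 * d = 4 * n := by
      have : ((m : ℤ) - d) % 2 = 0 := by omega
      exact ⟨(-(tE : ℤ) - m + d) / 2, by omega⟩
    rw [hn] at hvk
    have hkl := v_sub_map_le_of_thetaFixed_even hρρ hΘρ hF4 hΘP hP hdP hΘk hvk
    have h1 : Valued.v (ω * (k - ρ k)) ≤ exp (-(2 * (tE : ℤ)) - 2 * m - 2 * d') := by
      rw [map_mul, hω]
      refine (mul_le_mul' le_rfl hkl).trans ?_
      rw [hvk, ← exp_add, ← exp_add, exp_le_exp]; omega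
    have h2' : Valued.v (ξp - ρ ξp) ≤ exp (-(2 * (tE : ℤ)) - 2 * m - 2 * d') :=
      hvp.trans (by rw [exp_le_exp]; omega)
    have hsum : Valued.v (2 * (ξ - ρ ξ)) ≤ exp (-(2 * (tE : ℤ)) - 2 * m - 2 * d') := by
      rw [hdec]; exact (Valuation.map_add _ _ _).trans (max_le h2' h1)
    rw [hv2diff, exp_le_exp] at hsum
    omega
  · intro hpar
    -- odd K♮-order: `|ω(k − ρk)| = exp(−2tE − 2m + 2 − 2d′)` EXACTLY and `|ξ⁺ − ρξ⁺| ≤ exp(−4m)` is smaller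
    obtain ⟨n, hn⟩ : ∃ n : ℤ, -(2 * (tE : ℤ)) - 2 * m + 2 * d = 4 * n + 2 := by
      have : ((m : ℤ) - d) % 2 ≠ 0 := by omega
      exact ⟨(-(tE : ℤ) - m + d - 1) / 2, by omega⟩
    rw [hn] at hvk
    have hke := v_sub_map_eq_of_thetaFixed_odd hρρ hΘρ hF4 hΘP hP hdP hΘk hvk
    have h1 : Valued.v (ω * (k - ρ k)) = exp (-(2 * (tE : ℤ)) - 2 * m + 2 - 2 * d') := by
      rw [map_mul, hω, hke, hvk, ← exp_add, ← exp_add]; congr 1; omega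
    have hlt : Valued.v (ξp - ρ ξp) < Valued.v (ω * (k - ρ k)) := by
      refine hvp.trans_lt ?_
      rw [h1, exp_lt_exp]; omega
    have hsum : Valued.v (2 * (ξ - ρ ξ)) = exp (-(2 * (tE : ℤ)) - 2 * m + 2 - 2 * d') := by
      rw [hdec, Valuation.map_add_eq_of_lt_right _ hlt, h1]
    rw [hv2diff, exp_inj] at hsum
    omega

/-- **COROLLARY: T5s EDITION 2's token `hparW`** in its own letters (`g + s0 = d`): `m % 2 = (g + s0) % 2 ∨ jl + 2 ≤ m + 2·g + s0` (the off-parity branch sits at `jl = m + s0 − 1`, inside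
the window since `1 ≤ g`), together with `m ≤ jl`. [cite: Serre1979, Ch. IV §1 Prop. 3–4] [cite: Rogawski1990, §4.9 p. 55, Lemma 4.9.3 p. 56] -/
theorem hparW_of_frame_ramM (hρρ : ∀ x, ρ (ρ x) = x) (hvρ : ∀ x, Valued.v (ρ x) = Valued.v x)
    (hΘΘ : ∀ x, Θ (Θ x) = x) (hΘρ : ∀ x, Θ (ρ x) = ρ (Θ x)) (hvΘ : ∀ x, Valued.v (Θ x) = Valued.v x)
    (hF4 : ∀ z : K, ρ z = z → Θ z = z → z ≠ 0 → ∃ n : ℤ, Valued.v z = exp (4 * n))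
    {P : K} (hΘP : Θ P = P) (hP : Valued.v P = exp (-2 : ℤ)) {d' : ℕ} (hdP : Valued.v (P - ρ P) = exp (-(2 * (d' : ℤ))))
    {ω : K} (hρω : ρ ω = ω) (hΘω : Θ ω = -ω) {g s0 : ℕ} (hg : 1 ≤ g) (hs0 : 1 ≤ s0) (hω : Valued.v ω = exp (-(2 * ((g + s0 : ℕ) : ℤ))))
    {tE : ℕ} (h2 : Valued.v (2 : K) = exp (-(2 * (tE : ℤ)))) {dρ : ℕ} (hd' : 2 * d' = dρ + 2 * s0)
    {lam u : K} (hlam : Θ lam * lam = 1) (hu : ρ u = u) (hu1 : u * Θ u = 1)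
    {m jl : ℕ} (hm : Valued.v (lam - u) = exp (-(2 * (m : ℤ)))) (hjl : Valued.v ((lam - u) - ρ (lam - u)) = exp (-(2 * (jl : ℤ) + dρ)))
    (hdepth : d' + tE ≤ m) :
    (m % 2 = (g + s0) % 2 ∨ jl + 2 ≤ m + 2 * g + s0) ∧ m ≤ jl := by
  have hd1 : 1 ≤ d' := by omega
  obtain ⟨hon, hoff⟩ := realizable_of_frame_ramM hρρ hvρ hΘΘ hΘρ hvΘ hF4 hΘP hP hdP hρω hΘω hω h2 hd' hlam hu hu1 hm hjl hd1 hdepth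
  by_cases hpar : m % 2 = (g + s0) % 2
  · have hj : m + s0 ≤ jl := hon hpar
    exact ⟨Or.inl hpar, by omega⟩
  · have hj : jl + 1 = m + s0 := hoff hpar
    refine ⟨Or.inr ?_, ?_⟩ <;> omega

end Summit.HodgeConjecture.HodgeConjecture.Cruxes.H413.F0P3cDyRamTokenRealizabilityRamM

end
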